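/-
Copyright (c) 2026 the pub-hodgecm-mathlib formalisation cell (harness21).  Prover seat hodgecm-mathlib-K2Liu-p08 (g5), Track B «K2-LIT»,
#184♮ = hLiu418 = `stmt-HodgeConjecture-24832`; #42S organ S1 ROAD W, (G) organ (ρ-mid) SPLIT HAND, brick (M2a-L)-split: THE SPLIT WITNESS READ ALONG A LEVI ROW —
the split twin of ★ `K2LiuWitnessLeviReading` (K2Liu-p01 (g10)), feeding ★∕📤 `K2LiuSplitMiddleProfileFactorisation` ((M2b)-split).
-/
import Summits.HodgeConjecture.HodgeConjecture.Theorems.K2LiuWitnessLeviReading           -- ★ (M2a-L) inert: `forall_valued_mul_le_iff`, `valued_le_and_not_le_iff_eq`, `zpow_valued_toPlace_eq_exp`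
import Literature.NumberTheory.Automorphic.AddCharConductorExponent                     -- ★ `mem_primePowBall_adicCompletion_iff` (the `𝔭`-letter dictionary)
import HarnessLib

/-!
# Crux `HLiu418`, #42S-S1 ROAD W, (G) organ (ρ-mid) SPLIT HAND, brick (M2a-L)-split: THE SPLIT WITNESS READ ALONG A LEVI ROW

Cell `hodgecm-mathlib`, crux item hLiu418 = `stmt-HodgeConjecture-24832` (helper lane `--supports … --as helper`, count-neutral).  THEOREMS ONLY (no `def`, no instance,
no notation, no named-fact hypothesis, no `sorry`).  Generic number-field extension `E/F`, finite place `v` of `F` with uniformiser `π` (`hπ`), a place `w₀ ∣ v` with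
`hπw : v_{w₀}(ϖ) = exp(−1)` (automatic at a SPLIT `w₀`, `e = 1`), `K = E_{w₀}`, `P := v_{w₀}(ϖ)`.

WHY.  At a place `v` split in `E` the split witness `Φ_k = 𝟙_{B₁(k)} − 𝟙_{B₂(k)}` of ★ `K2LiuSplitWitnessPackage` ∕ ★ `K2LiuSplitWitnessPackageOfMoverFrame` lives on SIX blocks
`y = (B″, B′, A′, A″, C′, C″) ∈ (K²)⁶` (the `(w₀, w̄₀)`-reading `z ↦ (z′, z″) = (z(w₀), (σz)(w₀))` of ★ `K2LiuLocalRingSplitReading` applied to the three-block frame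
coordinates `(a, b, c)`; row «regrouping» of ★ `…OfMoverFrame`: `κ′ = (b″, b′, a′, a″, c′, c″)`), with `B₁(k) = {A′, A″, B′, B″ ∈ 𝒪², C′, C″ ∈ ϖ^k𝒪²}` and
`B₂(k) = B₁(k) ∩ {B′, B″ ∈ ϖ𝒪²}`.  Along a Levi row the frame coordinates are `(α·a_{i·}, β·a_{i·}, γ·a_{i·})` with `α, β, γ ∈ E ⊗ F_v` and `a_{i·}` a row of
`a ∈ GL₂(E ⊗ F_v)`; reading componentwise (`(x·y)′ = x′y′`, `(x·y)″ = x″y″`) the six blocks are `(β″a″, β′a′, α′a′, α″a″, γ′a′, γ″a″)` with TWO non-zero rows `a′, a″ ∈ K²`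
of exponents `n′, n″` (★ inert `exists_row_exponent`).  THIS FILE reads `𝟙_{B₁(k)} − 𝟙_{B₂(k)}` there (pure valuation algebra, the box bytes of ★ (P1)-split VERBATIM):
* §1 `mem_box6One_iff`, `mem_box6Two_iff` (★ inert `forall_valued_mul_le_iff` six times);
* §2 **`indicator_box6One_sub_box6Two_levi`** = `𝟙[v α′ ≤ P^{n′}, v α″ ≤ P^{n″}, v γ′ ≤ P^{n′+k}, v γ″ ≤ P^{n″+k}]·(𝟙[v β′ ≤ P^{n′} ∧ v β″ ≤ P^{n″}] − 𝟙[v β′ ≤ P^{n′+1} ∧ v β″ ≤ P^{n″+1}])`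
  as ONE `if`, and **`indicator_box6One_sub_box6Two_levi_eq_indicator_prod`**: the same as the indicator of the product set `((U ×ˢ C) ×ˢ B)` at `(((β′,β″),(γ′,γ″)),(α′,α″))`,
  `B = {v ≤ P^{n′}} × {v ≤ P^{n″}}`, `C = {v ≤ P^{n′+k}} × {v ≤ P^{n″+k}}`, `U = ({v ≤ P^{n′}} × {v ≤ P^{n″}}) ∖ ({v ≤ P^{n′+1}} × {v ≤ P^{n″+1}})` — NOT a shell: one of `β′, β″` is on
  its shell, the other is free (the difference from the inert hand, where `U = {v β = P^n}`);
* §3 the `𝔭`-letter dictionary `setOf_valued_le_zpow_eq_primePowBall` (`{v ≤ P^m} = 𝔭^m`, ★ `mem_primePowBall_adicCompletion_iff`) and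
  **`indicator_box6One_sub_box6Two_levi_eq_indicator_primePowBall`**: the integration domain of 📤 `K2LiuSplitMiddleProfileFactorisation.setIntegral_splitMiddleProfile_balls`
  ∕ `splitMiddleRows_of_balls` BYTE-FOR-BYTE (`((U ×ˢ (𝔭^{n′+k} ×ˢ 𝔭^{n″+k})) ×ˢ (𝔭^{n′} ×ˢ 𝔭^{n″}))`, `U = (𝔭^{n′} ×ˢ 𝔭^{n″}) ∖ (𝔭^{n′+1} ×ˢ 𝔭^{n″+1})`).
[Kudla1994, §3 Thm. 3.1] [KudlaSweet1997, §1] [WeilBNT1967, Ch. II §5 Prop. 12] [CasselsFrohlichANT1967, Ch. II §10] [Shimura1997, §13.2].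
HONEST LABEL.  Count-neutral helper; `HC_CM` is proved only modulo the 7 printed citations (2 remaining named inputs: hLiu418 = `stmt-HodgeConjecture-24832`,
h413 = `stmt-HodgeConjecture-24833`) until rung 0 closes.  NOT here: the (C1)–(C3) letters (K2Liu-p26 (g0)) and their split instantiation (M2a-C)-split, the phase reading
`Tr(α·σβ + D₀·γ·σγ) = α′β″ + α″β′ + D·γ′γ″` (★ `K2LiuLocalRingSplitReading.reading_mul_conjLocal`), the measure transport `E ⊗ F_v → K × K`.

## References
* [Kudla1994] S. S. Kudla, Israel J. Math. 87 (1994), §3 Thm. 3.1.   * [KudlaSweet1997] S. Kudla, W. J. Sweet, Israel J. Math. 98 (1997), §1.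
* [WeilBNT1967] A. Weil, *Basic Number Theory* (1967), Ch. II §5 Prop. 12.   * [CasselsFrohlichANT1967] Cassels–Fröhlich, *Algebraic Number Theory* (1967), Ch. II §10.
* [Shimura1997] G. Shimura, *Euler Products and Eisenstein Series*, CBMS 93 (1997), §13.2.
-/

set_option autoImplicit false
set_option linter.dupNamespace false -- the mandated namespace repeats `HodgeConjecture.HodgeConjecture`

noncomputable section

open NumberField IsDedekindDomain MeasureTheory Set
open Literature.NumberTheory.Automorphic Literature.NumberTheory.Automorphic.UnitaryGroup
open Literature.NumberTheory.GaloisRepresentations.IsNonarchimedeanLocalField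
open Summit.HodgeConjecture.HodgeConjecture.Cruxes.HLiu418.K2LiuWitnessLeviReading

namespace Summit.HodgeConjecture.HodgeConjecture.Cruxes.HLiu418.K2LiuSplitWitnessLeviReading

variable (F : Type) [Field F] [NumberField F] (E : Type) [Field E] [NumberField E] [Algebra F E]
  (v : HeightOneSpectrum (𝓞 F)) {π : v.adicCompletion F} (hπ : Valued.v π = WithZero.exp (-1 : ℤ))
  (w₀ : PlacesOver E v) (hπw : Valued.v (toPlace v w₀ π) = WithZero.exp (-1 : ℤ))

/-! ## §1 Membership of the split Levi row `(β″a″, β′a′, α′a′, α″a″, γ′a′, γ″a″)` in the six-block boxes -/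

include hπ in
/-- membership of the split Levi row in the OUTER six-block box `B₁(k)` (bytes of ★ (P1)-split `K2LiuSplitWitnessPackage`). [cite: Kudla1994, §3 Thm. 3.1] [cite: Shimura1997, §13.2] -/
theorem mem_box6One_iff {a' a'' : Fin 2 → w₀.1.adicCompletion E} {n' n'' : ℤ}
    (hle' : ∀ j, Valued.v (a' j) ≤ Valued.v (toPlace v w₀ π) ^ (-n')) (heq' : ∃ j, Valued.v (a' j) = Valued.v (toPlace v w₀ π) ^ (-n'))
    (hle'' : ∀ j, Valued.v (a'' j) ≤ Valued.v (toPlace v w₀ π) ^ (-n'')) (heq'' : ∃ j, Valued.v (a'' j) = Valued.v (toPlace v w₀ π) ^ (-n'')) (k : ℕ)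
    (α' α'' β' β'' γ' γ'' : w₀.1.adicCompletion E) :
    ((fun j => β'' * a'' j, fun j => β' * a' j, fun j => α' * a' j, fun j => α'' * a'' j, fun j => γ' * a' j, fun j => γ'' * a'' j) : (Fin 2 → w₀.1.adicCompletion E) × (Fin 2 → w₀.1.adicCompletion E) × (Fin 2 → w₀.1.adicCompletion E) × (Fin 2 → w₀.1.adicCompletion E) × (Fin 2 → w₀.1.adicCompletion E) × (Fin 2 → w₀.1.adicCompletion E)) ∈
      {y : ((Fin 2 → w₀.1.adicCompletion E) × (Fin 2 → w₀.1.adicCompletion E) × (Fin 2 → w₀.1.adicCompletion E) × (Fin 2 → w₀.1.adicCompletion E) × (Fin 2 → w₀.1.adicCompletion E) × (Fin 2 → w₀.1.adicCompletion E)) | (∀ i, Valued.v (y.1 i) ≤ 1) ∧ (∀ i, Valued.v (y.2.1 i) ≤ 1) ∧ (∀ i, Valued.v (y.2.2.1 i) ≤ 1) ∧ (∀ i, Valued.v (y.2.2.2.1 i) ≤ 1) ∧ (∀ i, Valued.v (y.2.2.2.2.1 i) ≤ Valued.v (toPlace v w₀ π) ^ k) ∧ ∀ i, Valued.v (y.2.2.2.2.2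 i) ≤ Valued.v (toPlace v w₀ π) ^ k} ↔
    Valued.v β'' ≤ Valued.v (toPlace v w₀ π) ^ n'' ∧ Valued.v β' ≤ Valued.v (toPlace v w₀ π) ^ n' ∧ Valued.v α' ≤ Valued.v (toPlace v w₀ π) ^ n' ∧ Valued.v α'' ≤ Valued.v (toPlace v w₀ π) ^ n'' ∧
      Valued.v γ' ≤ Valued.v (toPlace v w₀ π) ^ (n' + k) ∧ Valued.v γ'' ≤ Valued.v (toPlace v w₀ π) ^ (n'' + k) := by
  have h0' : ∀ z : w₀.1.adicCompletion E, (∀ j, Valued.v (z * a' j) ≤ 1) ↔ Valued.v z ≤ Valued.v (toPlace v w₀ π) ^ n' := fun z => by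
    have h := forall_valued_mul_le_iff F E v hπ w₀ hle' heq' z 0
    rwa [zpow_zero, zero_add] at h
  have h0'' : ∀ z : w₀.1.adicCompletion E, (∀ j, Valued.v (z * a'' j) ≤ 1) ↔ Valued.v z ≤ Valued.v (toPlace v w₀ π) ^ n'' := fun z => by
    have h := forall_valued_mul_le_iff F E v hπ w₀ hle'' heq'' z 0
    rwa [zpow_zero, zero_add] at h
  have hk' : ∀ z : w₀.1.adicCompletion E, (∀ j, Valued.v (z * a' j) ≤ Valued.v (toPlace v w₀ π) ^ k) ↔ Valued.v z ≤ Valued.v (toPlace v w₀ π) ^ (n' + k) := fun z => by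
    have h := forall_valued_mul_le_iff F E v hπ w₀ hle' heq' z k
    rwa [zpow_natCast, add_comm (k : ℤ) n'] at h
  have hk'' : ∀ z : w₀.1.adicCompletion E, (∀ j, Valued.v (z * a'' j) ≤ Valued.v (toPlace v w₀ π) ^ k) ↔ Valued.v z ≤ Valued.v (toPlace v w₀ π) ^ (n'' + k) := fun z => by
    have h := forall_valued_mul_le_iff F E v hπ w₀ hle'' heq'' z k
    rwa [zpow_natCast, add_comm (k : ℤ) n''] at h
  simp only [Set.mem_setOf_eq]
  rw [h0'' β'', h0' β', h0' α', h0'' α'', hk' γ', hk'' γ'']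

include hπ in
/-- membership of the split Levi row in the INNER six-block box `B₂(k) = B₁(k) ∩ {B′, B″ ∈ ϖ𝒪²}` (bytes of ★ (P1)-split). [cite: Kudla1994, §3 Thm. 3.1] [cite: Shimura1997, §13.2] -/
theorem mem_box6Two_iff {a' a'' : Fin 2 → w₀.1.adicCompletion E} {n' n'' : ℤ}
    (hle' : ∀ j, Valued.v (a' j) ≤ Valued.v (toPlace v w₀ π) ^ (-n')) (heq' : ∃ j, Valued.v (a' j) = Valued.v (toPlace v w₀ π) ^ (-n'))
    (hle'' : ∀ j, Valued.v (a'' j) ≤ Valued.v (toPlace v w₀ π) ^ (-n'')) (heq'' : ∃ j, Valued.v (a'' j) = Valued.v (toPlace v w₀ π) ^ (-n'')) (k : ℕ)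
    (α' α'' β' β'' γ' γ'' : w₀.1.adicCompletion E) :
    ((fun j => β'' * a'' j, fun j => β' * a' j, fun j => α' * a' j, fun j => α'' * a'' j, fun j => γ' * a' j, fun j => γ'' * a'' j) : (Fin 2 → w₀.1.adicCompletion E) × (Fin 2 → w₀.1.adicCompletion E) × (Fin 2 → w₀.1.adicCompletion E) × (Fin 2 → w₀.1.adicCompletion E) × (Fin 2 → w₀.1.adicCompletion E) × (Fin 2 → w₀.1.adicCompletion E)) ∈
      {y : ((Fin 2 → w₀.1.adicCompletion E) × (Fin 2 → w₀.1.adicCompletion E) × (Fin 2 → w₀.1.adicCompletion E) × (Fin 2 → w₀.1.adicCompletion E) × (Fin 2 → w₀.1.adicCompletion E) × (Fin 2 → w₀.1.adicCompletion E)) | ((∀ i, Valued.v (y.1 i) ≤ 1) ∧ (∀ i, Valued.v (y.2.1 i) ≤ 1) ∧ (∀ i, Valued.v (y.2.2.1 i) ≤ 1) ∧ (∀ i, Valued.v (y.2.2.2.1 i) ≤ 1) ∧ (∀ i, Valued.v (y.2.2.2.2.1 i) ≤ Valued.v (toPlace v w₀ π) ^ k) ∧ ∀ i, Valued.v (y.2.2.2.2.2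 i) ≤ Valued.v (toPlace v w₀ π) ^ k) ∧ ((∀ i, Valued.v (y.2.1 i) ≤ Valued.v (toPlace v w₀ π)) ∧ ∀ i, Valued.v (y.1 i) ≤ Valued.v (toPlace v w₀ π))} ↔
    (Valued.v β'' ≤ Valued.v (toPlace v w₀ π) ^ n'' ∧ Valued.v β' ≤ Valued.v (toPlace v w₀ π) ^ n' ∧ Valued.v α' ≤ Valued.v (toPlace v w₀ π) ^ n' ∧ Valued.v α'' ≤ Valued.v (toPlace v w₀ π) ^ n'' ∧
      Valued.v γ' ≤ Valued.v (toPlace v w₀ π) ^ (n' + k) ∧ Valued.v γ'' ≤ Valued.v (toPlace v w₀ π) ^ (n'' + k)) ∧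
      (Valued.v β' ≤ Valued.v (toPlace v w₀ π) ^ (n' + 1) ∧ Valued.v β'' ≤ Valued.v (toPlace v w₀ π) ^ (n'' + 1)) := by
  have h0' : ∀ z : w₀.1.adicCompletion E, (∀ j, Valued.v (z * a' j) ≤ 1) ↔ Valued.v z ≤ Valued.v (toPlace v w₀ π) ^ n' := fun z => by
    have h := forall_valued_mul_le_iff F E v hπ w₀ hle' heq' z 0
    rwa [zpow_zero, zero_add] at h
  have h0'' : ∀ z : w₀.1.adicCompletion E, (∀ j, Valued.v (z * a'' j) ≤ 1) ↔ Valued.v z ≤ Valued.v (toPlace v w₀ π) ^ n'' := fun z => by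
    have h := forall_valued_mul_le_iff F E v hπ w₀ hle'' heq'' z 0
    rwa [zpow_zero, zero_add] at h
  have hk' : ∀ z : w₀.1.adicCompletion E, (∀ j, Valued.v (z * a' j) ≤ Valued.v (toPlace v w₀ π) ^ k) ↔ Valued.v z ≤ Valued.v (toPlace v w₀ π) ^ (n' + k) := fun z => by
    have h := forall_valued_mul_le_iff F E v hπ w₀ hle' heq' z k
    rwa [zpow_natCast, add_comm (k : ℤ) n'] at h
  have hk'' : ∀ z : w₀.1.adicCompletion E, (∀ j, Valued.v (z * a'' j) ≤ Valued.v (toPlace v w₀ π) ^ k) ↔ Valued.v z ≤ Valued.v (toPlace v w₀ π) ^ (n'' + k) := fun z => by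
    have h := forall_valued_mul_le_iff F E v hπ w₀ hle'' heq'' z k
    rwa [zpow_natCast, add_comm (k : ℤ) n''] at h
  have h1' : ∀ z : w₀.1.adicCompletion E, (∀ j, Valued.v (z * a' j) ≤ Valued.v (toPlace v w₀ π)) ↔ Valued.v z ≤ Valued.v (toPlace v w₀ π) ^ (n' + 1) := fun z => by
    have h := forall_valued_mul_le_iff F E v hπ w₀ hle' heq' z 1
    rwa [zpow_one, add_comm (1 : ℤ) n'] at h
  have h1'' : ∀ z : w₀.1.adicCompletion E, (∀ j, Valued.v (z * a'' j) ≤ Valued.v (toPlace v w₀ π)) ↔ Valued.v z ≤ Valued.v (toPlace v w₀ π) ^ (n'' + 1) := fun z => by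
    have h := forall_valued_mul_le_iff F E v hπ w₀ hle'' heq'' z 1
    rwa [zpow_one, add_comm (1 : ℤ) n''] at h
  simp only [Set.mem_setOf_eq]
  rw [h0'' β'', h0' β', h0' α', h0'' α'', hk' γ', hk'' γ'', h1' β', h1'' β'']

/-! ## §2 THE READING of `𝟙_{B₁(k)} − 𝟙_{B₂(k)}` along the split Levi row -/

include hπ in
open scoped Classical in
/-- **THE SPLIT WITNESS READ ALONG A LEVI ROW**:
`(𝟙_{B₁(k)} − 𝟙_{B₂(k)})(β″a″, β′a′, α′a′, α″a″, γ′a′, γ″a″) = 𝟙[v α′ ≤ P^{n′} ∧ v α″ ≤ P^{n″} ∧ v γ′ ≤ P^{n′+k} ∧ v γ″ ≤ P^{n″+k} ∧ (v β′ ≤ P^{n′} ∧ v β″ ≤ P^{n″}) ∧ ¬(v β′ ≤ P^{n′+1} ∧ v β″ ≤ P^{n″+1})]`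
— the `b`-pair lands in `(𝔭^{n′} × 𝔭^{n″}) ∖ (𝔭^{n′+1} × 𝔭^{n″+1})`. [cite: Kudla1994, §3 Thm. 3.1] [cite: KudlaSweet1997, §1] [cite: WeilBNT1967, Ch. II §5 Prop. 12] -/
theorem indicator_box6One_sub_box6Two_levi {a' a'' : Fin 2 → w₀.1.adicCompletion E} {n' n'' : ℤ}
    (hle' : ∀ j, Valued.v (a' j) ≤ Valued.v (toPlace v w₀ π) ^ (-n')) (heq' : ∃ j, Valued.v (a' j) = Valued.v (toPlace v w₀ π) ^ (-n'))
    (hle'' : ∀ j, Valued.v (a'' j) ≤ Valued.v (toPlace v w₀ π) ^ (-n'')) (heq'' : ∃ j, Valued.v (a'' j) = Valued.v (toPlace v w₀ π) ^ (-n'')) (k : ℕ)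
    (α' α'' β' β'' γ' γ'' : w₀.1.adicCompletion E) :
    {y : ((Fin 2 → w₀.1.adicCompletion E) × (Fin 2 → w₀.1.adicCompletion E) × (Fin 2 → w₀.1.adicCompletion E) × (Fin 2 → w₀.1.adicCompletion E) × (Fin 2 → w₀.1.adicCompletion E) × (Fin 2 → w₀.1.adicCompletion E)) | (∀ i, Valued.v (y.1 i) ≤ 1) ∧ (∀ i, Valued.v (y.2.1 i) ≤ 1) ∧ (∀ i, Valued.v (y.2.2.1 i) ≤ 1) ∧ (∀ i, Valued.v (y.2.2.2.1 i) ≤ 1) ∧ (∀ i, Valued.v (y.2.2.2.2.1 i) ≤ Valued.v (toPlace v w₀ π) ^ k) ∧ ∀ i, Valued.v (y.2.2.2.2.2 i) ≤ Valued.v (toPlace v w₀ π) ^ k}.indicator (fun _ => (1 : ℂ))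
        ((fun j => β'' * a'' j, fun j => β' * a' j, fun j => α' * a' j, fun j => α'' * a'' j, fun j => γ' * a' j, fun j => γ'' * a'' j) : (Fin 2 → w₀.1.adicCompletion E) × (Fin 2 → w₀.1.adicCompletion E) × (Fin 2 → w₀.1.adicCompletion E) × (Fin 2 → w₀.1.adicCompletion E) × (Fin 2 → w₀.1.adicCompletion E) × (Fin 2 → w₀.1.adicCompletion E)) -
      {y : ((Fin 2 → w₀.1.adicCompletion E) × (Fin 2 → w₀.1.adicCompletion E) × (Fin 2 → w₀.1.adicCompletion E) × (Fin 2 → w₀.1.adicCompletion E) × (Fin 2 → w₀.1.adicCompletion E) × (Fin 2 → w₀.1.adicCompletion E)) | ((∀ i, Valued.v (y.1 i) ≤ 1) ∧ (∀ i, Valued.v (y.2.1 i) ≤ 1) ∧ (∀ i, Valued.v (y.2.2.1 i) ≤ 1) ∧ (∀ i, Valued.v (y.2.2.2.1 i) ≤ 1) ∧ (∀ i, Valued.v (y.2.2.2.2.1 i) ≤ Valued.v (toPlace v w₀ π) ^ k) ∧ ∀ i, Valued.v (y.2.2.2.2.2 i) ≤ Valued.v (toPlace v w₀ π) ^ k)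 ∧ ((∀ i, Valued.v (y.2.1 i) ≤ Valued.v (toPlace v w₀ π)) ∧ ∀ i, Valued.v (y.1 i) ≤ Valued.v (toPlace v w₀ π))}.indicator (fun _ => (1 : ℂ))
        ((fun j => β'' * a'' j, fun j => β' * a' j, fun j => α' * a' j, fun j => α'' * a'' j, fun j => γ' * a' j, fun j => γ'' * a'' j) : (Fin 2 → w₀.1.adicCompletion E) × (Fin 2 → w₀.1.adicCompletion E) × (Fin 2 → w₀.1.adicCompletion E) × (Fin 2 → w₀.1.adicCompletion E) × (Fin 2 → w₀.1.adicCompletion E) × (Fin 2 → w₀.1.adicCompletion E)) =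
    if Valued.v α' ≤ Valued.v (toPlace v w₀ π) ^ n' ∧ Valued.v α'' ≤ Valued.v (toPlace v w₀ π) ^ n'' ∧ Valued.v γ' ≤ Valued.v (toPlace v w₀ π) ^ (n' + k) ∧ Valued.v γ'' ≤ Valued.v (toPlace v w₀ π) ^ (n'' + k) ∧
        (Valued.v β' ≤ Valued.v (toPlace v w₀ π) ^ n' ∧ Valued.v β'' ≤ Valued.v (toPlace v w₀ π) ^ n'') ∧ ¬ (Valued.v β' ≤ Valued.v (toPlace v w₀ π) ^ (n' + 1) ∧ Valued.v β'' ≤ Valued.v (toPlace v w₀ π) ^ (n'' + 1)) then 1 else 0 := by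
  have e1 := if_congr (mem_box6One_iff F E v hπ w₀ hle' heq' hle'' heq'' k α' α'' β' β'' γ' γ'') (rfl : (1 : ℂ) = 1) (rfl : (0 : ℂ) = 0)
  have e2 := if_congr (mem_box6Two_iff F E v hπ w₀ hle' heq' hle'' heq'' k α' α'' β' β'' γ' γ'') (rfl : (1 : ℂ) = 1) (rfl : (0 : ℂ) = 0)
  rw [Set.indicator_apply, Set.indicator_apply, e1, e2]
  by_cases hα' : Valued.v α' ≤ Valued.v (toPlace v w₀ π) ^ n' <;>
  by_cases hα'' : Valued.v α'' ≤ Valued.v (toPlace v w₀ π) ^ n'' <;>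
  by_cases hβ' : Valued.v β' ≤ Valued.v (toPlace v w₀ π) ^ n' <;>
  by_cases hβ'' : Valued.v β'' ≤ Valued.v (toPlace v w₀ π) ^ n'' <;>
  by_cases hβ1 : Valued.v β' ≤ Valued.v (toPlace v w₀ π) ^ (n' + 1) ∧ Valued.v β'' ≤ Valued.v (toPlace v w₀ π) ^ (n'' + 1) <;>
  by_cases hγ' : Valued.v γ' ≤ Valued.v (toPlace v w₀ π) ^ (n' + k) <;>
  by_cases hγ'' : Valued.v γ'' ≤ Valued.v (toPlace v w₀ π) ^ (n'' + k) <;>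
  simp [hα', hα'', hβ', hβ'', hβ1, hγ', hγ'']

include hπ in
open scoped Classical in
/-- **THE SAME READING AS A PRODUCT-SET INDICATOR** in 📤 (M2b)-split's integration order `(((β′,β″),(γ′,γ″)),(α′,α″)) ∈ (U ×ˢ C) ×ˢ B` with the valuation-letter sets
`B = {v ≤ P^{n′}} ×ˢ {v ≤ P^{n″}}`, `C = {v ≤ P^{n′+k}} ×ˢ {v ≤ P^{n″+k}}`, `U = ({v ≤ P^{n′}} ×ˢ {v ≤ P^{n″}}) ∖ ({v ≤ P^{n′+1}} ×ˢ {v ≤ P^{n″+1}})`.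
[cite: Kudla1994, §3 Thm. 3.1] [cite: KudlaSweet1997, §1] -/
theorem indicator_box6One_sub_box6Two_levi_eq_indicator_prod {a' a'' : Fin 2 → w₀.1.adicCompletion E} {n' n'' : ℤ}
    (hle' : ∀ j, Valued.v (a' j) ≤ Valued.v (toPlace v w₀ π) ^ (-n')) (heq' : ∃ j, Valued.v (a' j) = Valued.v (toPlace v w₀ π) ^ (-n'))
    (hle'' : ∀ j, Valued.v (a'' j) ≤ Valued.v (toPlace v w₀ π) ^ (-n'')) (heq'' : ∃ j, Valued.v (a'' j) = Valued.v (toPlace v w₀ π) ^ (-n'')) (k : ℕ)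
    (α' α'' β' β'' γ' γ'' : w₀.1.adicCompletion E) :
    {y : ((Fin 2 → w₀.1.adicCompletion E) × (Fin 2 → w₀.1.adicCompletion E) × (Fin 2 → w₀.1.adicCompletion E) × (Fin 2 → w₀.1.adicCompletion E) × (Fin 2 → w₀.1.adicCompletion E) × (Fin 2 → w₀.1.adicCompletion E)) | (∀ i, Valued.v (y.1 i) ≤ 1) ∧ (∀ i, Valued.v (y.2.1 i) ≤ 1) ∧ (∀ i, Valued.v (y.2.2.1 i) ≤ 1) ∧ (∀ i, Valued.v (y.2.2.2.1 i) ≤ 1) ∧ (∀ i, Valued.v (y.2.2.2.2.1 i) ≤ Valued.v (toPlace v w₀ π) ^ k) ∧ ∀ i, Valued.v (y.2.2.2.2.2 i) ≤ Valued.v (toPlace v w₀ π) ^ k}.indicator (fun _ => (1 : ℂ))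
        ((fun j => β'' * a'' j, fun j => β' * a' j, fun j => α' * a' j, fun j => α'' * a'' j, fun j => γ' * a' j, fun j => γ'' * a'' j) : (Fin 2 → w₀.1.adicCompletion E) × (Fin 2 → w₀.1.adicCompletion E) × (Fin 2 → w₀.1.adicCompletion E) × (Fin 2 → w₀.1.adicCompletion E) × (Fin 2 → w₀.1.adicCompletion E) × (Fin 2 → w₀.1.adicCompletion E)) -
      {y : ((Fin 2 → w₀.1.adicCompletion E) × (Fin 2 → w₀.1.adicCompletion E) × (Fin 2 → w₀.1.adicCompletion E) × (Fin 2 → w₀.1.adicCompletion E) × (Fin 2 → w₀.1.adicCompletion E) × (Fin 2 → w₀.1.adicCompletion E)) | ((∀ i, Valued.v (y.1 i) ≤ 1) ∧ (∀ i, Valued.v (y.2.1 i) ≤ 1) ∧ (∀ i, Valued.v (y.2.2.1 i) ≤ 1) ∧ (∀ i, Valued.v (y.2.2.2.1 i) ≤ 1) ∧ (∀ i, Valued.v (y.2.2.2.2.1 i) ≤ Valued.v (toPlace v w₀ π) ^ k) ∧ ∀ i, Valued.v (y.2.2.2.2.2 i) ≤ Valued.v (toPlace v w₀ π) ^ k)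 ∧ ((∀ i, Valued.v (y.2.1 i) ≤ Valued.v (toPlace v w₀ π)) ∧ ∀ i, Valued.v (y.1 i) ≤ Valued.v (toPlace v w₀ π))}.indicator (fun _ => (1 : ℂ))
        ((fun j => β'' * a'' j, fun j => β' * a' j, fun j => α' * a' j, fun j => α'' * a'' j, fun j => γ' * a' j, fun j => γ'' * a'' j) : (Fin 2 → w₀.1.adicCompletion E) × (Fin 2 → w₀.1.adicCompletion E) × (Fin 2 → w₀.1.adicCompletion E) × (Fin 2 → w₀.1.adicCompletion E) × (Fin 2 → w₀.1.adicCompletion E) × (Fin 2 → w₀.1.adicCompletion E)) =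
    (((({z : w₀.1.adicCompletion E | Valued.v z ≤ Valued.v (toPlace v w₀ π) ^ (n')} ×ˢ {z : w₀.1.adicCompletion E | Valued.v z ≤ Valued.v (toPlace v w₀ π) ^ (n'')}) \ ({z : w₀.1.adicCompletion E | Valued.v z ≤ Valued.v (toPlace v w₀ π) ^ (n' + 1)} ×ˢ {z : w₀.1.adicCompletion E | Valued.v z ≤ Valued.v (toPlace v w₀ π) ^ (n'' + 1)})) ×ˢ ({z : w₀.1.adicCompletion E | Valued.v z ≤ Valued.v (toPlace v w₀ π) ^ (n' + k)} ×ˢ {z : w₀.1.adicCompletion E | Valued.v z ≤ Valued.v (toPlace v w₀ π) ^ (n'' + k)})) ×ˢ ({z : w₀.1.adicCompletion E | Valued.v z ≤ Valued.v (toPlace v w₀ π) ^ (n')} ×ˢ {z : w₀.1.adicCompletion E | Valued.v z ≤ Valued.v (toPlace v w₀ π) ^ (n'')})).indicator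
      (fun _ => (1 : ℂ)) (((β', β''), (γ', γ'')), (α', α'')) := by
  rw [indicator_box6One_sub_box6Two_levi F E v hπ w₀ hle' heq' hle'' heq'' k α' α'' β' β'' γ' γ'', Set.indicator_apply]
  simp only [Set.mem_prod, Set.mem_sdiff, Set.mem_setOf_eq]
  by_cases hα' : Valued.v α' ≤ Valued.v (toPlace v w₀ π) ^ n' <;>
  by_cases hα'' : Valued.v α'' ≤ Valued.v (toPlace v w₀ π) ^ n'' <;>
  by_cases hβ' : Valued.v β' ≤ Valued.v (toPlace v w₀ π) ^ n' <;>
  by_cases hβ'' : Valued.v β'' ≤ Valued.v (toPlace v w₀ π) ^ n'' <;>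
  by_cases hβ1 : Valued.v β' ≤ Valued.v (toPlace v w₀ π) ^ (n' + 1) ∧ Valued.v β'' ≤ Valued.v (toPlace v w₀ π) ^ (n'' + 1) <;>
  by_cases hγ' : Valued.v γ' ≤ Valued.v (toPlace v w₀ π) ^ (n' + k) <;>
  by_cases hγ'' : Valued.v γ'' ≤ Valued.v (toPlace v w₀ π) ^ (n'' + k) <;>
  simp [hα', hα'', hβ', hβ'', hβ1, hγ', hγ'']

/-! ## §3 The `𝔭`-letter dictionary and the (M2b)-split integration domain -/

include hπw in
/-- **`{z | v z ≤ P^m} = 𝔭^m`** in `K = E_{w₀}` (★ `mem_primePowBall_adicCompletion_iff`, `P^m = exp(−m)`). [cite: CasselsFrohlichANT1967, Ch. II §10] -/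
theorem setOf_valued_le_zpow_eq_primePowBall (m : ℤ) :
    {z : w₀.1.adicCompletion E | Valued.v z ≤ Valued.v (toPlace v w₀ π) ^ (m)} = primePowBall (w₀.1.adicCompletion E) m := by
  ext z
  rw [Set.mem_setOf_eq, mem_primePowBall_adicCompletion_iff, zpow_valued_toPlace_eq_exp F E v w₀ hπw]

include hπ hπw in
open scoped Classical in
/-- **THE SPLIT LEVI-ROW READING IN `𝔭`-LETTERS** — the integration domain of 📤 `K2LiuSplitMiddleProfileFactorisation.setIntegral_splitMiddleProfile_balls` ∕
`splitMiddleRows_of_balls` byte-for-byte: `(𝟙_{B₁(k)} − 𝟙_{B₂(k)})(split Levi row) = 𝟙_{((U ×ˢ (𝔭^{n′+k} ×ˢ 𝔭^{n″+k})) ×ˢ (𝔭^{n′} ×ˢ 𝔭^{n″}))}(((β′,β″),(γ′,γ″)),(α′,α″))`,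
`U = (𝔭^{n′} ×ˢ 𝔭^{n″}) ∖ (𝔭^{n′+1} ×ˢ 𝔭^{n″+1})`. [cite: Kudla1994, §3 Thm. 3.1] [cite: KudlaSweet1997, §1] [cite: Tate1950, §2.5] -/
theorem indicator_box6One_sub_box6Two_levi_eq_indicator_primePowBall {a' a'' : Fin 2 → w₀.1.adicCompletion E} {n' n'' : ℤ}
    (hle' : ∀ j, Valued.v (a' j) ≤ Valued.v (toPlace v w₀ π) ^ (-n')) (heq' : ∃ j, Valued.v (a' j) = Valued.v (toPlace v w₀ π) ^ (-n'))
    (hle'' : ∀ j, Valued.v (a'' j) ≤ Valued.v (toPlace v w₀ π) ^ (-n'')) (heq'' : ∃ j, Valued.v (a'' j) = Valued.v (toPlace v w₀ π) ^ (-n'')) (k : ℕ)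
    (α' α'' β' β'' γ' γ'' : w₀.1.adicCompletion E) :
    {y : ((Fin 2 → w₀.1.adicCompletion E) × (Fin 2 → w₀.1.adicCompletion E) × (Fin 2 → w₀.1.adicCompletion E) × (Fin 2 → w₀.1.adicCompletion E) × (Fin 2 → w₀.1.adicCompletion E) × (Fin 2 → w₀.1.adicCompletion E)) | (∀ i, Valued.v (y.1 i) ≤ 1) ∧ (∀ i, Valued.v (y.2.1 i) ≤ 1) ∧ (∀ i, Valued.v (y.2.2.1 i) ≤ 1) ∧ (∀ i, Valued.v (y.2.2.2.1 i) ≤ 1) ∧ (∀ i, Valued.v (y.2.2.2.2.1 i) ≤ Valued.v (toPlace v w₀ π) ^ k) ∧ ∀ i, Valued.v (y.2.2.2.2.2 i) ≤ Valued.v (toPlace v w₀ π) ^ k}.indicator (fun _ => (1 : ℂ))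
        ((fun j => β'' * a'' j, fun j => β' * a' j, fun j => α' * a' j, fun j => α'' * a'' j, fun j => γ' * a' j, fun j => γ'' * a'' j) : (Fin 2 → w₀.1.adicCompletion E) × (Fin 2 → w₀.1.adicCompletion E) × (Fin 2 → w₀.1.adicCompletion E) × (Fin 2 → w₀.1.adicCompletion E) × (Fin 2 → w₀.1.adicCompletion E) × (Fin 2 → w₀.1.adicCompletion E)) -
      {y : ((Fin 2 → w₀.1.adicCompletion E) × (Fin 2 → w₀.1.adicCompletion E) × (Fin 2 → w₀.1.adicCompletion E) × (Fin 2 → w₀.1.adicCompletion E) × (Fin 2 → w₀.1.adicCompletion E) × (Fin 2 → w₀.1.adicCompletion E)) | ((∀ i, Valued.v (y.1 i) ≤ 1) ∧ (∀ i, Valued.v (y.2.1 i) ≤ 1) ∧ (∀ i, Valued.v (y.2.2.1 i) ≤ 1) ∧ (∀ i, Valued.v (y.2.2.2.1 i) ≤ 1) ∧ (∀ i, Valued.v (y.2.2.2.2.1 i) ≤ Valued.v (toPlace v w₀ π) ^ k) ∧ ∀ i, Valued.v (y.2.2.2.2.2 i) ≤ Valued.v (toPlace v w₀ π) ^ k)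 ∧ ((∀ i, Valued.v (y.2.1 i) ≤ Valued.v (toPlace v w₀ π)) ∧ ∀ i, Valued.v (y.1 i) ≤ Valued.v (toPlace v w₀ π))}.indicator (fun _ => (1 : ℂ))
        ((fun j => β'' * a'' j, fun j => β' * a' j, fun j => α' * a' j, fun j => α'' * a'' j, fun j => γ' * a' j, fun j => γ'' * a'' j) : (Fin 2 → w₀.1.adicCompletion E) × (Fin 2 → w₀.1.adicCompletion E) × (Fin 2 → w₀.1.adicCompletion E) × (Fin 2 → w₀.1.adicCompletion E) × (Fin 2 → w₀.1.adicCompletion E) × (Fin 2 → w₀.1.adicCompletion E)) =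
    ((((primePowBall (w₀.1.adicCompletion E) (n') ×ˢ primePowBall (w₀.1.adicCompletion E) (n'')) \ (primePowBall (w₀.1.adicCompletion E) (n' + 1) ×ˢ primePowBall (w₀.1.adicCompletion E) (n'' + 1))) ×ˢ (primePowBall (w₀.1.adicCompletion E) (n' + k) ×ˢ primePowBall (w₀.1.adicCompletion E) (n'' + k))) ×ˢ (primePowBall (w₀.1.adicCompletion E) (n') ×ˢ primePowBall (w₀.1.adicCompletion E) (n''))).indicator
      (fun _ => (1 : ℂ)) (((β', β''), (γ', γ'')), (α', α'')) := by
  rw [indicator_box6One_sub_box6Two_levi_eq_indicator_prod F E v hπ w₀ hle' heq' hle'' heq'' k α' α'' β' β'' γ' γ'',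
    setOf_valued_le_zpow_eq_primePowBall F E v w₀ hπw, setOf_valued_le_zpow_eq_primePowBall F E v w₀ hπw,
    setOf_valued_le_zpow_eq_primePowBall F E v w₀ hπw, setOf_valued_le_zpow_eq_primePowBall F E v w₀ hπw,
    setOf_valued_le_zpow_eq_primePowBall F E v w₀ hπw, setOf_valued_le_zpow_eq_primePowBall F E v w₀ hπw]

end Summit.HodgeConjecture.HodgeConjecture.Cruxes.HLiu418.K2LiuSplitWitnessLeviReading
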